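import Mathlib.Tactic.Linarith
import Mathlib.Tactic.Ring
import Mathlib.Tactic.Zify
import Mathlib.Tactic.IntervalCases
import Mathlib.Tactic.Positivity
import HarnessLib

/-!
# Arithmetic of the eight vertex constraints: the law gap `4 ∣ 8N − 3V`

ω-census, family (b3).  Framing: lottery ticket; floor = certified bounds/negative ranges.

Abstract setting (`DihedralLikeVertexCounting.lean`): non-negative integers `s₀, s₁, t₀, t₁, u₀, u₁` (coset part
sizes), box products `p_{ijk} = s_i t_j u_k`, volume `V = (s₀+s₁)(t₀+t₁)(u₀+u₁) = ∑ p_{ijk}`, and a modulus `N` with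
the eight **vertex constraints** `∑_{e ∼ m} p_e ≤ N` (`m ∈ {0,1}³`, `e ∼ m` the three boxes adjacent to `m`).
Summing them gives `3V ≤ 8N`.  Write `D = 8N − 3V ≥ 0` for the total slack.

**Theorem (`four_dvd_of_vertex_bounds`).** If `V ≥ 33` and `D ≤ 13` then `4 ∣ D`.

Consequences (`DihedralLikeLawGap.lean`): for `N ≡ 2 (mod 3)` (`D ≡ 1 (mod 3)`), `D ≤ 13` forces `D = 4`, i.e. a TPP
triple of a dihedral-like group of order `2N` has volume exactly the law `(8N−4)/3` or at most `law − 4`; for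
`N ≡ 1 (mod 3)` the values `law + 1, law + 2` allowed by plain counting and `law − 1` never occur; for `3 ∣ N` the
values `law − 1, law − 2, law − 3` never occur.

**Proof.** The four *antipodal sums* `P₁ = p₀₀₀+p₁₁₁, P₂ = p₁₀₀+p₀₁₁, P₃ = p₀₁₀+p₁₀₁, P₄ = p₀₀₁+p₁₁₀` satisfy
`V − Pᵢ ≤ 2N` (sum of two antipodal vertex constraints), whence `|X|, |Y|, |Z| ≤ D` for
`X = (s₀+s₁)(t₀−t₁)(u₀−u₁) = P₁+P₂−P₃−P₄` and its two analogues.  If two of the three size pairs are balanced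
(`t₀ = t₁`, `u₀ = u₁`, say) then `4 ∣ 3V` trivially.  If exactly one is balanced (`s₀ = s₁ = s`), the vertex
constraint omitting the smallest product `t_j u_k` gives `2s(TU − 4 min t_ju_k) ≤ D`, forcing `V ≤ 32`
(`one_balanced_core`).  If none is balanced, `|X|,|Y|,|Z| ≤ 13` bound `s₀+s₁, t₀+t₁, u₀+u₁ ≤ 13` and a finite check
(`vertex_fc`, 37 560 cases by `decide`) shows `V ≤ 32`.
-/

namespace Summit.MatrixMultiplication.OmegaCensus

/-! ## One balanced pair: `V ≤ 32` -/

/-- Core of the one-balanced case (`s₀ = s₁ = s`, `t₀ < t₁`, `u₀ < u₁`): the vertex constraint omitting `t₀u₀`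
together with `8N ≤ 3V + 13` forces `V ≤ 32`. [folklore] -/
theorem one_balanced_core (N s t₀ t₁ u₀ u₁ : ℕ) (ht : t₀ < t₁) (hu : u₀ < u₁)
    (hL : s * t₁ * u₁ + s * t₀ * u₁ + s * t₁ * u₀ ≤ N)
    (hD : 8 * N ≤ 3 * ((s + s) * (t₀ + t₁) * (u₀ + u₁)) + 13) :
    (s + s) * (t₀ + t₁) * (u₀ + u₁) ≤ 32 := by
  obtain ⟨a, rfl⟩ : ∃ a, t₁ = t₀ + a + 1 := ⟨t₁ - t₀ - 1, by omega⟩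
  obtain ⟨b, rfl⟩ : ∃ b, u₁ = u₀ + b + 1 := ⟨u₁ - u₀ - 1, by omega⟩
  have h1 : 8 * (s * (t₀ + a + 1) * (u₀ + b + 1) + s * t₀ * (u₀ + b + 1) + s * (t₀ + a + 1) * u₀) ≤
      3 * ((s + s) * (t₀ + (t₀ + a + 1)) * (u₀ + (u₀ + b + 1))) + 13 := le_trans (Nat.mul_le_mul_left 8 hL) hD
  -- the slack inequality: `s (4 t₀ b + 4 t₀ + 4 a u₀ + 4 u₀ + 2ab + 2a + 2b + 2) ≤ 13`
  have h2 : s * (4 * t₀ * b + 4 * t₀ + 4 * a * u₀ + 4 * u₀ + 2 * a * b + 2 * a + 2 * b + 2) ≤ 13 := by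
    nlinarith [h1]
  -- hence `V ≤ 8 s t₀ u₀ + 13` and the small cases
  have hV : (s + s) * (t₀ + (t₀ + a + 1)) * (u₀ + (u₀ + b + 1)) =
      8 * (s * t₀ * u₀) + s * (4 * t₀ * b + 4 * t₀ + 4 * a * u₀ + 4 * u₀ + 2 * a * b + 2 * a + 2 * b + 2) := by
    ring
  rcases Nat.eq_zero_or_pos s with rfl | hs
  · simp
  have h3 : 4 * t₀ * b + 4 * t₀ + 4 * a * u₀ + 4 * u₀ + 2 * a * b + 2 * a + 2 * b + 2 ≤ 13 :=
    le_trans (Nat.le_mul_of_pos_left _ hs) h2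
  have h4 : s * 2 ≤ 13 := le_trans (Nat.mul_le_mul_left s (by omega)) h2
  have ht0 : t₀ ≤ 2 := by omega
  have hu0 : u₀ ≤ 2 := by omega
  have hs13 : s ≤ 6 := by omega
  rw [hV]
  interval_cases t₀ <;> interval_cases u₀ <;> interval_cases s <;> omega

/-- The one-balanced case is impossible under `V ≥ 33`, `8N ≤ 3V + 13`: all four "omit one product `t_j u_k`"
vertex constraints are available when `s₀ = s₁ = s`. [folklore] -/
theorem one_balanced_false (N s t₀ t₁ u₀ u₁ : ℕ) (ht : t₀ ≠ t₁) (hu : u₀ ≠ u₁)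
    (h00 : s * t₁ * u₁ + s * t₀ * u₁ + s * t₁ * u₀ ≤ N) (h11 : s * t₀ * u₀ + s * t₁ * u₀ + s * t₀ * u₁ ≤ N)
    (h01 : s * t₀ * u₀ + s * t₁ * u₀ + s * t₁ * u₁ ≤ N) (h10 : s * t₀ * u₀ + s * t₀ * u₁ + s * t₁ * u₁ ≤ N)
    (hV : 33 ≤ (s + s) * (t₀ + t₁) * (u₀ + u₁)) (hD : 8 * N ≤ 3 * ((s + s) * (t₀ + t₁) * (u₀ + u₁)) + 13) :
    False := by
  rcases Nat.lt_or_gt_of_ne ht with ht' | ht' <;> rcases Nat.lt_or_gt_of_ne hu with hu' | hu'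
  · have := one_balanced_core N s t₀ t₁ u₀ u₁ ht' hu' h00 hD
    omega
  · -- `t₀ < t₁`, `u₁ < u₀`: omit `t₀ u₁`
    have hD' : 8 * N ≤ 3 * ((s + s) * (t₀ + t₁) * (u₁ + u₀)) + 13 := by rwa [add_comm u₁ u₀]
    have := one_balanced_core N s t₀ t₁ u₁ u₀ ht' hu' (by linarith) hD'
    rw [add_comm u₁ u₀] at this
    omega
  · -- `t₁ < t₀`, `u₀ < u₁`: omit `t₁ u₀`
    have hD' : 8 * N ≤ 3 * ((s + s) * (t₁ + t₀) * (u₀ + u₁)) + 13 := by rwa [add_comm t₁ t₀]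
    have := one_balanced_core N s t₁ t₀ u₀ u₁ ht' hu' (by linarith) hD'
    rw [add_comm t₁ t₀] at this
    omega
  · -- `t₁ < t₀`, `u₁ < u₀`: omit `t₁ u₁`
    have hD' : 8 * N ≤ 3 * ((s + s) * (t₁ + t₀) * (u₁ + u₀)) + 13 := by rwa [add_comm t₁ t₀, add_comm u₁ u₀]
    have := one_balanced_core N s t₁ t₀ u₁ u₀ ht' hu' (by linarith) hD'
    rw [add_comm t₁ t₀, add_comm u₁ u₀] at this
    omega

/-! ## No balanced pair: a finite check -/

set_option maxHeartbeats 400000 in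
/-- The finite check for the all-unbalanced case: with `d(x,y) = x − y + (y − x)` (= `|x − y|` in `ℕ`), for all
size vectors with `s₀+s₁ ≤ 13`, `t₀+t₁ ≤ 13 / d(s₀,s₁)`, `u₀+u₁ ≤ 13 / (d(s₀,s₁) d(t₀,t₁))`, all three pairs
unbalanced and `V ≥ 33`, one of the eight inequalities `8 · (vertex sum) ≤ 3V + 13` fails (37 560 evaluations).
[folklore] -/
theorem vertex_fc :
    ((List.range 14).all fun s₀ => (List.range (14 - s₀)).all fun s₁ =>
      (List.range (13 / (s₀ - s₁ + (s₁ - s₀)) + 1)).all fun t₀ =>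
      (List.range (13 / (s₀ - s₁ + (s₁ - s₀)) + 1 - t₀)).all fun t₁ =>
      (List.range (13 / ((s₀ - s₁ + (s₁ - s₀)) * (t₀ - t₁ + (t₁ - t₀))) + 1)).all fun u₀ =>
      (List.range (13 / ((s₀ - s₁ + (s₁ - s₀)) * (t₀ - t₁ + (t₁ - t₀))) + 1 - u₀)).all fun u₁ =>
        decide (s₀ ≠ s₁ → t₀ ≠ t₁ → u₀ ≠ u₁ → 33 ≤ (s₀ + s₁) * (t₀ + t₁) * (u₀ + u₁) →
          8 * (s₁ * t₀ * u₀ + s₀ * t₁ * u₀ + s₀ * t₀ * u₁) ≤ 3 * ((s₀ + s₁) * (t₀ + t₁) * (u₀ + u₁)) + 13 →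
          8 * (s₀ * t₁ * u₁ + s₁ * t₀ * u₁ + s₁ * t₁ * u₀) ≤ 3 * ((s₀ + s₁) * (t₀ + t₁) * (u₀ + u₁)) + 13 →
          8 * (s₀ * t₀ * u₀ + s₁ * t₁ * u₀ + s₁ * t₀ * u₁) ≤ 3 * ((s₀ + s₁) * (t₀ + t₁) * (u₀ + u₁)) + 13 →
          8 * (s₁ * t₁ * u₁ + s₀ * t₀ * u₁ + s₀ * t₁ * u₀) ≤ 3 * ((s₀ + s₁) * (t₀ + t₁) * (u₀ + u₁)) + 13 →
          8 * (s₁ * t₁ * u₀ + s₀ * t₀ * u₀ + s₀ * t₁ * u₁) ≤ 3 * ((s₀ + s₁) * (t₀ + t₁) * (u₀ + u₁)) + 13 →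
          8 * (s₀ * t₀ * u₁ + s₁ * t₁ * u₁ + s₁ * t₀ * u₀) ≤ 3 * ((s₀ + s₁) * (t₀ + t₁) * (u₀ + u₁)) + 13 →
          8 * (s₁ * t₀ * u₁ + s₀ * t₁ * u₁ + s₀ * t₀ * u₀) ≤ 3 * ((s₀ + s₁) * (t₀ + t₁) * (u₀ + u₁)) + 13 →
          8 * (s₀ * t₁ * u₀ + s₁ * t₀ * u₀ + s₁ * t₁ * u₁) ≤ 3 * ((s₀ + s₁) * (t₀ + t₁) * (u₀ + u₁)) + 13 →
          False)) = true := by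
  decide

/-- `d(x,y) = x − y + (y − x)` cast to `ℤ` is `|x − y|`. [folklore] -/
theorem natDist_cast (x y : ℕ) : (((x - y + (y - x) : ℕ)) : ℤ) = |(x : ℤ) - y| := by
  rcases le_total x y with h | h
  · rw [Nat.sub_eq_zero_of_le h, zero_add, Nat.cast_sub h, abs_of_nonpos (by simpa using h), neg_sub]
  · rw [Nat.sub_eq_zero_of_le h, add_zero, Nat.cast_sub h, abs_of_nonneg (by simpa using h)]

/-- The all-unbalanced case is impossible: `|X|, |Y|, |Z| ≤ 13` bound the three sizes and `vertex_fc` applies.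
[folklore] -/
theorem unbalanced_false (N s₀ s₁ t₀ t₁ u₀ u₁ : ℕ) (hs : s₀ ≠ s₁) (ht : t₀ ≠ t₁) (hu : u₀ ≠ u₁)
    (h000 : s₁ * t₀ * u₀ + s₀ * t₁ * u₀ + s₀ * t₀ * u₁ ≤ N) (h111 : s₀ * t₁ * u₁ + s₁ * t₀ * u₁ + s₁ * t₁ * u₀ ≤ N)
    (h100 : s₀ * t₀ * u₀ + s₁ * t₁ * u₀ + s₁ * t₀ * u₁ ≤ N) (h011 : s₁ * t₁ * u₁ + s₀ * t₀ * u₁ + s₀ * t₁ * u₀ ≤ N)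
    (h010 : s₁ * t₁ * u₀ + s₀ * t₀ * u₀ + s₀ * t₁ * u₁ ≤ N) (h101 : s₀ * t₀ * u₁ + s₁ * t₁ * u₁ + s₁ * t₀ * u₀ ≤ N)
    (h001 : s₁ * t₀ * u₁ + s₀ * t₁ * u₁ + s₀ * t₀ * u₀ ≤ N) (h110 : s₀ * t₁ * u₀ + s₁ * t₀ * u₀ + s₁ * t₁ * u₁ ≤ N)
    (hV : 33 ≤ (s₀ + s₁) * (t₀ + t₁) * (u₀ + u₁)) (hD : 8 * N ≤ 3 * ((s₀ + s₁) * (t₀ + t₁) * (u₀ + u₁)) + 13) :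
    False := by
  -- integer versions
  have z000 : ((s₁ * t₀ * u₀ + s₀ * t₁ * u₀ + s₀ * t₀ * u₁ : ℕ) : ℤ) ≤ N := by exact_mod_cast h000
  have z111 : ((s₀ * t₁ * u₁ + s₁ * t₀ * u₁ + s₁ * t₁ * u₀ : ℕ) : ℤ) ≤ N := by exact_mod_cast h111
  have z100 : ((s₀ * t₀ * u₀ + s₁ * t₁ * u₀ + s₁ * t₀ * u₁ : ℕ) : ℤ) ≤ N := by exact_mod_cast h100
  have z011 : ((s₁ * t₁ * u₁ + s₀ * t₀ * u₁ + s₀ * t₁ * u₀ : ℕ) : ℤ) ≤ N := by exact_mod_cast h011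
  have z010 : ((s₁ * t₁ * u₀ + s₀ * t₀ * u₀ + s₀ * t₁ * u₁ : ℕ) : ℤ) ≤ N := by exact_mod_cast h010
  have z101 : ((s₀ * t₀ * u₁ + s₁ * t₁ * u₁ + s₁ * t₀ * u₀ : ℕ) : ℤ) ≤ N := by exact_mod_cast h101
  have z001 : ((s₁ * t₀ * u₁ + s₀ * t₁ * u₁ + s₀ * t₀ * u₀ : ℕ) : ℤ) ≤ N := by exact_mod_cast h001
  have z110 : ((s₀ * t₁ * u₀ + s₁ * t₀ * u₀ + s₁ * t₁ * u₁ : ℕ) : ℤ) ≤ N := by exact_mod_cast h110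
  have zD : ((8 * N : ℕ) : ℤ) ≤ ((3 * ((s₀ + s₁) * (t₀ + t₁) * (u₀ + u₁)) + 13 : ℕ) : ℤ) := by exact_mod_cast hD
  push_cast at z000 z111 z100 z011 z010 z101 z001 z110 zD
  -- `|X|, |Y|, |Z| ≤ 13`
  have hX : ((s₀ + s₁ : ℕ) : ℤ) * |((t₀ : ℤ) - t₁) * ((u₀ : ℤ) - u₁)| ≤ 13 := by
    rw [← abs_of_nonneg (by positivity : (0 : ℤ) ≤ ((s₀ + s₁ : ℕ) : ℤ)), ← abs_mul]
    push_cast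
    exact abs_le.2 ⟨by linarith, by linarith⟩
  have hY : ((t₀ + t₁ : ℕ) : ℤ) * |((s₀ : ℤ) - s₁) * ((u₀ : ℤ) - u₁)| ≤ 13 := by
    rw [← abs_of_nonneg (by positivity : (0 : ℤ) ≤ ((t₀ + t₁ : ℕ) : ℤ)), ← abs_mul]
    push_cast
    exact abs_le.2 ⟨by linarith, by linarith⟩
  have hZ : ((u₀ + u₁ : ℕ) : ℤ) * |((s₀ : ℤ) - s₁) * ((t₀ : ℤ) - t₁)| ≤ 13 := by
    rw [← abs_of_nonneg (by positivity : (0 : ℤ) ≤ ((u₀ + u₁ : ℕ) : ℤ)), ← abs_mul]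
    push_cast
    exact abs_le.2 ⟨by linarith, by linarith⟩
  -- back to `ℕ` with `d(x,y) = x - y + (y - x)`
  have ds1 : 1 ≤ s₀ - s₁ + (s₁ - s₀) := by omega
  have dt1 : 1 ≤ t₀ - t₁ + (t₁ - t₀) := by omega
  have du1 : 1 ≤ u₀ - u₁ + (u₁ - u₀) := by omega
  have nX : (s₀ + s₁) * ((t₀ - t₁ + (t₁ - t₀)) * (u₀ - u₁ + (u₁ - u₀))) ≤ 13 := by
    have h : (((s₀ + s₁) * ((t₀ - t₁ + (t₁ - t₀)) * (u₀ - u₁ + (u₁ - u₀))) : ℕ) : ℤ) ≤ 13 := by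
      rw [Nat.cast_mul, Nat.cast_mul, natDist_cast, natDist_cast, ← abs_mul]; exact hX
    exact_mod_cast h
  have nY : (t₀ + t₁) * ((s₀ - s₁ + (s₁ - s₀)) * (u₀ - u₁ + (u₁ - u₀))) ≤ 13 := by
    have h : (((t₀ + t₁) * ((s₀ - s₁ + (s₁ - s₀)) * (u₀ - u₁ + (u₁ - u₀))) : ℕ) : ℤ) ≤ 13 := by
      rw [Nat.cast_mul, Nat.cast_mul, natDist_cast, natDist_cast, ← abs_mul]; exact hY
    exact_mod_cast h
  have nZ : (u₀ + u₁) * ((s₀ - s₁ + (s₁ - s₀)) * (t₀ - t₁ + (t₁ - t₀))) ≤ 13 := by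
    have h : (((u₀ + u₁) * ((s₀ - s₁ + (s₁ - s₀)) * (t₀ - t₁ + (t₁ - t₀))) : ℕ) : ℤ) ≤ 13 := by
      rw [Nat.cast_mul, Nat.cast_mul, natDist_cast, natDist_cast, ← abs_mul]; exact hZ
    exact_mod_cast h
  -- loop bounds
  have hS : s₀ + s₁ ≤ 13 := le_trans (Nat.le_mul_of_pos_right _ (Nat.mul_pos dt1 du1)) nX
  have hT : t₀ + t₁ ≤ 13 / (s₀ - s₁ + (s₁ - s₀)) := by
    rw [Nat.le_div_iff_mul_le ds1]
    calc (t₀ + t₁) * (s₀ - s₁ + (s₁ - s₀)) ≤ (t₀ + t₁) * ((s₀ - s₁ + (s₁ - s₀)) * (u₀ - u₁ + (u₁ - u₀))) :=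
          Nat.mul_le_mul_left _ (Nat.le_mul_of_pos_right _ du1)
      _ ≤ 13 := nY
  have hU : u₀ + u₁ ≤ 13 / ((s₀ - s₁ + (s₁ - s₀)) * (t₀ - t₁ + (t₁ - t₀))) := by
    rw [Nat.le_div_iff_mul_le (Nat.mul_pos ds1 dt1)]
    exact nZ
  have key := vertex_fc
  simp only [List.all_eq_true, List.mem_range, decide_eq_true_iff] at key
  exact key s₀ (by omega) s₁ (by omega) t₀ (by omega) t₁ (by omega) u₀ (by omega) u₁ (by omega) hs ht hu hV
    (by omega) (by omega) (by omega) (by omega) (by omega) (by omega) (by omega) (by omega)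

/-! ## The law gap -/

/-- **`4 ∣ 8N − 3V`** whenever the eight vertex constraints hold, `V ≥ 33` and the total slack `8N − 3V` is at
most `13`. [folklore] -/
theorem four_dvd_of_vertex_bounds (N s₀ s₁ t₀ t₁ u₀ u₁ : ℕ)
    (h000 : s₁ * t₀ * u₀ + s₀ * t₁ * u₀ + s₀ * t₀ * u₁ ≤ N) (h111 : s₀ * t₁ * u₁ + s₁ * t₀ * u₁ + s₁ * t₁ * u₀ ≤ N)
    (h100 : s₀ * t₀ * u₀ + s₁ * t₁ * u₀ + s₁ * t₀ * u₁ ≤ N) (h011 : s₁ * t₁ * u₁ + s₀ * t₀ * u₁ + s₀ * t₁ * u₀ ≤ N)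
    (h010 : s₁ * t₁ * u₀ + s₀ * t₀ * u₀ + s₀ * t₁ * u₁ ≤ N) (h101 : s₀ * t₀ * u₁ + s₁ * t₁ * u₁ + s₁ * t₀ * u₀ ≤ N)
    (h001 : s₁ * t₀ * u₁ + s₀ * t₁ * u₁ + s₀ * t₀ * u₀ ≤ N) (h110 : s₀ * t₁ * u₀ + s₁ * t₀ * u₀ + s₁ * t₁ * u₁ ≤ N)
    (hV : 33 ≤ (s₀ + s₁) * (t₀ + t₁) * (u₀ + u₁)) (hD : 8 * N ≤ 3 * ((s₀ + s₁) * (t₀ + t₁) * (u₀ + u₁)) + 13) :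
    4 ∣ 8 * N - 3 * ((s₀ + s₁) * (t₀ + t₁) * (u₀ + u₁)) := by
  have h8 : 4 ∣ 8 * N := ⟨2 * N, by ring⟩
  by_cases hs : s₀ = s₁ <;> by_cases ht : t₀ = t₁ <;> by_cases hu : u₀ = u₁
  · subst hs; subst ht
    exact Nat.dvd_sub h8 ⟨3 * s₀ * t₀ * (u₀ + u₁), by ring⟩
  · subst hs; subst ht
    exact Nat.dvd_sub h8 ⟨3 * s₀ * t₀ * (u₀ + u₁), by ring⟩
  · subst hs; subst hu
    exact Nat.dvd_sub h8 ⟨3 * s₀ * (t₀ + t₁) * u₀, by ring⟩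
  · subst hs
    exact (one_balanced_false N s₀ t₀ t₁ u₀ u₁ ht hu (by linarith) (by linarith) (by linarith) (by linarith)
      hV hD).elim
  · subst ht; subst hu
    exact Nat.dvd_sub h8 ⟨3 * (s₀ + s₁) * t₀ * u₀, by ring⟩
  · -- `t` balanced only: rotate roles `(t, u, s)`
    subst ht
    refine (one_balanced_false N t₀ u₀ u₁ s₀ s₁ hu hs (by linarith) (by linarith) (by linarith) (by linarith)
      ?_ ?_).elim
    · have e : (t₀ + t₀) * (u₀ + u₁) * (s₀ + s₁) = (s₀ + s₁) * (t₀ + t₀) * (u₀ + u₁) := by ring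
      rw [e]; exact hV
    · have e : (t₀ + t₀) * (u₀ + u₁) * (s₀ + s₁) = (s₀ + s₁) * (t₀ + t₀) * (u₀ + u₁) := by ring
      rw [e]; exact hD
  · -- `u` balanced only: roles `(u, s, t)`
    subst hu
    refine (one_balanced_false N u₀ s₀ s₁ t₀ t₁ hs ht (by linarith) (by linarith) (by linarith) (by linarith)
      ?_ ?_).elim
    · have e : (u₀ + u₀) * (s₀ + s₁) * (t₀ + t₁) = (s₀ + s₁) * (t₀ + t₁) * (u₀ + u₀) := by ring
      rw [e]; exact hV
    · have e : (u₀ + u₀) * (s₀ + s₁) * (t₀ + t₁) = (s₀ + s₁) * (t₀ + t₁) * (u₀ + u₀) := by ring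
      rw [e]; exact hD
  · exact (unbalanced_false N s₀ s₁ t₀ t₁ u₀ u₁ hs ht hu h000 h111 h100 h011 h010 h101 h001 h110 hV hD).elim

end Summit.MatrixMultiplication.OmegaCensus
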